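/-
Copyright (c) 2026 the pub-hodgecm-mathlib formalisation cell (harness21).  Prover seat hodgecm-mathlib-K2Liu-p08 (g5), Track B «K2-LIT»,
#184♮ = hLiu418 = `stmt-HodgeConjecture-24832`; #42S organ S1 (vii): THE NON-SPLIT FACE OF RECORD `hS1ns` — THE DISPATCH BY RAMIFICATION, hypothesis-first on the
inert-unramified branch (K2Liu-p01 ED. 4 ∘ LH7-p08 record re-keying) and the ramified branch (F0P2-p07 core ∘ record letters), Π-letters only.
-/
import Summits.HodgeConjecture.HodgeConjecture.Theorems.K2LiuLocalSWSpanningSplitOfMoverMiddleRowsGeneral  -- ★ the record-face vocabulary (p08)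
import Summits.HodgeConjecture.HodgeConjecture.Theorems.K2LiuLocalSWSpanningSplitFaceLetters                 -- ★ `isSquare_cmQuadraticGenerator_iff_exists_smul_ne` (p08)
import HarnessLib

/-!
# Crux `HLiu418`, #42S organ S1 (vii): THE NON-SPLIT FACE OF RECORD `hS1ns` — DISPATCH BY RAMIFICATION

Cell `hodgecm-mathlib`, crux item hLiu418 = `stmt-HodgeConjecture-24832`; squad K2 ∕ K2Liu; LEAD F0P6-plan (g15); S1 DESK LH7-p08 (g2); prover K2Liu-p08 (g5).
THEOREMS ONLY (no `def`, no instance, no notation, no named-fact hypothesis, no `sorry`); lane `--supports stmt-HodgeConjecture-24832 --as helper`.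

WHAT.  The `hS1ns` binder of the #42S END head ★ `K2LiuStandardSectionSpanBySWGeneratorsEndGuarded.standardSectionSpanBySWGenerators_of_S1_S5_guarded` (ll. 61–80) hands the
non-split face ONLY the place `v`, the scalar `c₁` with the second frame `dV₁ = c₁ · dV₀`, the letter `¬ IsSquare (ι_v θ_L)` and the sign `(c₁, θ_L)_v = −1`.  The two ★
chains that pay it are keyed to the RAMIFICATION TYPE of `v` in `L`: the inert-unramified chain (K2Liu-p01: ★ (C2c) → ★ `…InertOfPackages` → ★ ED. 3 `…InertFaceCore` → ED. 4
`…InertFaceFinal`, re-keyed at the record by the S1 desk's `hS1ns_inert_of_record`) and the ramified chain (F0P2-p07: ★ `…RamifiedOfChain` → `…RamifiedCore` → record letters).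
THIS FILE is the dispatch, hypothesis-first on the two branch faces as Π-LETTERS in the END head's own currency (LH4-p09 (g10) 00:15:16Z: no ∃-telescopes — they do not
elaborate at 4 000 000):
* **`hS1ns_of_branches (hI) (hR) : ‹hS1ns, bytes ll. 61–80 VERBATIM›`**, where `hI` ∕ `hR` are the SAME bytes with, inserted before the inequality, the place letters
  `∀ (w₀ : PlacesOver L v), c • w₀ = w₀ → Algebra.IsUnramifiedIn (𝓞 L) v.asIdeal →` (resp. `¬ Algebra.IsUnramifiedIn …`).  Inside: `w₀` exists (★ `PlacesOver.nonempty`), it is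
  fixed by `c` because `v` is non-split (★ `isSquare_cmQuadraticGenerator_iff_exists_smul_ne`), and `by_cases` on the ramification.
ED. 2 (when the two FINAL heads are ★ at the record) replaces `hI`, `hR` by names; the split twin is ★∕📤 `K2LiuLocalSWSpanningSplitFaceClosed.hS1sp_of_record` (zero hypotheses).
References: [Kudla1994] §3 Thm. 3.1; [KudlaSweet1997] Thm. 1.2; [HarrisKudlaSweet1996] §6 Prop. 6.2, 6.4; [CasselsFrohlichANT1967] Ch. I §5–§7 (ramification), Ch. II §10.
HONEST LABEL.  Count-neutral helper, hypothesis-first on `hI`, `hR`: `HC_CM` is proved only modulo the 7 printed citations (2 remaining named inputs: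
hLiu418 = `stmt-HodgeConjecture-24832`, h413 = `stmt-HodgeConjecture-24833`) until rung 0 closes.

## References
* [Kudla1994] S. S. Kudla, Israel J. Math. 87 (1994), §3 Thm. 3.1.  * [KudlaSweet1997] S. Kudla, W. J. Sweet, Israel J. Math. 98 (1997), Thm. 1.2.
* [HarrisKudlaSweet1996] M. Harris, S. Kudla, W. J. Sweet, J. Amer. Math. Soc. 9 (1996), §6.
* [CasselsFrohlichANT1967] J. W. S. Cassels, A. Fröhlich (eds.), *Algebraic Number Theory* (1967), Ch. I §5–§7, Ch. II §10.
-/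

set_option autoImplicit false
set_option linter.dupNamespace false -- the mandated namespace repeats `HodgeConjecture.HodgeConjecture`

noncomputable section

open scoped Matrix
open NumberField IsDedekindDomain
open Literature.RepresentationTheory.HeisenbergGroup
open Literature.NumberTheory.QuadraticForms
open Literature.NumberTheory.Automorphic Literature.NumberTheory.Automorphic.UnitaryGroup Literature.NumberTheory.GaloisRepresentations
open Literature.NumberTheory.Weil1964 Literature.RepresentationTheory.HarrisKudlaSweet1996
open Literature.NumberTheory.GelbartRogawski1991 Literature.NumberTheory.GelbartRogawski1991.GRConstruction Literature.NumberTheory.GelbartRogawski1991.UnitaryDualPair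
open Literature.NumberTheory.GelbartRogawski1991.UnitaryDualPair.LocalSplitting
open Literature.NumberTheory.K2Lit.SiegelDoubled Literature.NumberTheory.K2Lit.LocalSiegelDoubled
open Summit.HodgeConjecture.HodgeConjecture.Cruxes.HLiu418.K2LiuLocalSWSectionDefs Summit.HodgeConjecture.HodgeConjecture.Cruxes.HLiu418.K2LiuLocalSWImageDefs
open Summit.HodgeConjecture.HodgeConjecture.Cruxes.HLiu418.K2LiuSWSectionPlaceFactorisation
open Summit.HodgeConjecture.HodgeConjecture.Cruxes.HLiu418.K2LiuLocalSWSpanningSplitFaceLetters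

namespace Summit.HodgeConjecture.HodgeConjecture.Cruxes.HLiu418.K2LiuLocalSWSpanningNonsplitFaceClosed

set_option maxHeartbeats 800000 in -- MEASURED: as ★ `K2LiuLocalSWSpanningSplitFace.hS1sp_of_middleRows` (the END head's telescope, here three copies)
open scoped Classical in
/-- **`hS1ns` OF THE #42S END HEAD FROM ITS TWO RAMIFICATION BRANCHES** (Π-letters): `hI` = the inert-unramified branch (place `w₀` fixed by `c`, `v` unramified in `L`),
`hR` = the ramified branch; conclusion = the END head's `hS1ns` binder bytes ll. 61–80 VERBATIM.  The place `w₀` exists and is fixed by `c` because `v` is non-split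
(★ `isSquare_cmQuadraticGenerator_iff_exists_smul_ne`). [cite: Kudla1994, §3 Thm. 3.1] [cite: CasselsFrohlichANT1967, Ch. I §5–§7, Ch. II §10] -/
theorem hS1ns_of_branches
    (hI : ∀ (L : Type) [Field L] [NumberField L] [IsCMField L] (e : Fin 2 × Fin 1 ≃ Fin 2)
        (dV : Fin 2 → L) (hdV : ∀ i, IsCMField.complexConj L (dV i) = dV i) (hdV0 : ∀ i, dV i ≠ 0)
        (dW : Fin 1 → L) (hdW : ∀ i, IsCMField.complexConj L (dW i) = dW i) (hdW0 : ∀ i, dW i ≠ 0)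
        {M' n' : ℕ} (eW : Fin 1 × Fin 3 ≃ Fin M') (e' : Fin 2 × Fin M' ≃ Fin n')
        (dV₀ : Fin 3 → L) (hdV₀ : ∀ k, IsCMField.complexConj L (dV₀ k) = dV₀ k) (hdV₀0 : ∀ k, dV₀ k ≠ 0)
        (χb : HeckeCharacter L) (hχbs : IsSplittingChar L 1 χb),
        ∀ (v : HeightOneSpectrum (𝓞 (Fp L))) (c₁ : (Fp L)ˣ) (dV₁ : Fin 3 → L) (hdV₁ : ∀ k, IsCMField.complexConj L (dV₁ k) = dV₁ k) (hdV₁0 : ∀ k, dV₁ k ≠ 0),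
        (∀ k, dV₁ k = ((c₁ : Fp L) : L) * dV₀ k) → ¬ IsSquare (algebraMap (Fp L) (v.adicCompletion (Fp L)) (cmQuadraticGenerator L : Fp L)) → hilbertSymbol (v.adicCompletion (Fp L)) (algebraMap (Fp L) _ ((c₁ : (Fp L)ˣ) : Fp L)) (algebraMap (Fp L) _ (cmQuadraticGenerator L : Fp L)) = -1 →
        ∀ (w₀ : PlacesOver L v), IsCMField.complexConj L • w₀.1 = w₀.1 → Algebra.IsUnramifiedIn (𝓞 L) v.asIdeal →
        localDegPS (Fp L) L (IsCMField.complexConj L) (complexConj_imagUnit L) (imagUnit_ne_zero L) (imagUnit_mul_self L)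
            v 2 (gramR_isSymm L e dV hdV dW hdW) (hermD_eq_map_gramD L e dV hdV dW hdW) (fun w => (χb ^ 3).localComponent w.1) ((((3 : ℕ) : ℂ) - ((2 : ℕ) : ℂ)) / 2) ≤
          localSWImage L e dV hdV dW hdW eW e' dV₀ hdV₀ v ((finSplittings L e' dV hdV hdV0 (tensorFrame L dW eW dV₀) (tensorFrame_real L dW hdW eW dV₀ hdV₀) (tensorFrame_ne_zero L dW eW dV₀ hdW0 hdV₀0) χb (borelPlaceMeasure L) (cmFinLocalFamily L e' dV hdV hdV0 (tensorFrame L dW eW dV₀) (tensorFrame_real L dW hdW eW dV₀ hdV₀) (tensorFrame_ne_zero L dW eW dV₀ hdW0 hdV₀0) χb hχbs (borelPlaceMeasure L))).s v)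
            ⟨(ratSpLoc (Fp L) (n' + n') (gramD L e' dV hdV (tensorFrame L dW eW dV₀) (tensorFrame_real L dW hdW eW dV₀ hdV₀))
                  (isUnit_det_gramD L e' dV hdV hdV0 (tensorFrame L dW eW dV₀) (tensorFrame_real L dW hdW eW dV₀ hdV₀) (tensorFrame_ne_zero L dW eW dV₀ hdW0 hdV₀0)) v (deltaD L),
                deltaImpl L e' dV hdV hdV0 (tensorFrame L dW eW dV₀) (tensorFrame_real L dW hdW eW dV₀ hdV₀) (tensorFrame_ne_zero L dW eW dV₀ hdW0 hdV₀0) χb (borelPlaceMeasure L) (cmFinLocalFamily L e' dV hdV hdV0 (tensorFrame L dW eW dV₀) (tensorFrame_real L dW hdW eW dV₀ hdV₀) (tensorFrame_ne_zero L dW eW dV₀ hdW0 hdV₀0) χb hχbs (borelPlaceMeasure L)) v),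
              deltaPair_mem_localMp L e' dV hdV hdV0 (tensorFrame L dW eW dV₀) (tensorFrame_real L dW hdW eW dV₀ hdV₀) (tensorFrame_ne_zero L dW eW dV₀ hdW0 hdV₀0) χb (borelPlaceMeasure L) (cmFinLocalFamily L e' dV hdV hdV0 (tensorFrame L dW eW dV₀) (tensorFrame_real L dW hdW eW dV₀ hdV₀) (tensorFrame_ne_zero L dW eW dV₀ hdW0 hdV₀0) χb hχbs (borelPlaceMeasure L)) v⟩ ⊔
          localSWImage L e dV hdV dW hdW eW e' dV₁ hdV₁ v ((finSplittings L e' dV hdV hdV0 (tensorFrame L dW eW dV₁) (tensorFrame_real L dW hdW eW dV₁ hdV₁) (tensorFrame_ne_zero L dW eW dV₁ hdW0 hdV₁0) χb (borelPlaceMeasure L) (cmFinLocalFamily L e' dV hdV hdV0 (tensorFrame L dW eW dV₁) (tensorFrame_real L dW hdW eW dV₁ hdV₁) (tensorFrame_ne_zero L dW eW dV₁ hdW0 hdV₁0) χb hχbs (borelPlaceMeasure L))).s v)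
            ⟨(ratSpLoc (Fp L) (n' + n') (gramD L e' dV hdV (tensorFrame L dW eW dV₁) (tensorFrame_real L dW hdW eW dV₁ hdV₁))
                  (isUnit_det_gramD L e' dV hdV hdV0 (tensorFrame L dW eW dV₁) (tensorFrame_real L dW hdW eW dV₁ hdV₁) (tensorFrame_ne_zero L dW eW dV₁ hdW0 hdV₁0)) v (deltaD L),
                deltaImpl L e' dV hdV hdV0 (tensorFrame L dW eW dV₁) (tensorFrame_real L dW hdW eW dV₁ hdV₁) (tensorFrame_ne_zero L dW eW dV₁ hdW0 hdV₁0) χb (borelPlaceMeasure L) (cmFinLocalFamily L e' dV hdV hdV0 (tensorFrame L dW eW dV₁) (tensorFrame_real L dW hdW eW dV₁ hdV₁) (tensorFrame_ne_zero L dW eW dV₁ hdW0 hdV₁0) χb hχbs (borelPlaceMeasure L)) v),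
              deltaPair_mem_localMp L e' dV hdV hdV0 (tensorFrame L dW eW dV₁) (tensorFrame_real L dW hdW eW dV₁ hdV₁) (tensorFrame_ne_zero L dW eW dV₁ hdW0 hdV₁0) χb (borelPlaceMeasure L) (cmFinLocalFamily L e' dV hdV hdV0 (tensorFrame L dW eW dV₁) (tensorFrame_real L dW hdW eW dV₁ hdV₁) (tensorFrame_ne_zero L dW eW dV₁ hdW0 hdV₁0) χb hχbs (borelPlaceMeasure L)) v⟩)
    (hR : ∀ (L : Type) [Field L] [NumberField L] [IsCMField L] (e : Fin 2 × Fin 1 ≃ Fin 2)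
        (dV : Fin 2 → L) (hdV : ∀ i, IsCMField.complexConj L (dV i) = dV i) (hdV0 : ∀ i, dV i ≠ 0)
        (dW : Fin 1 → L) (hdW : ∀ i, IsCMField.complexConj L (dW i) = dW i) (hdW0 : ∀ i, dW i ≠ 0)
        {M' n' : ℕ} (eW : Fin 1 × Fin 3 ≃ Fin M') (e' : Fin 2 × Fin M' ≃ Fin n')
        (dV₀ : Fin 3 → L) (hdV₀ : ∀ k, IsCMField.complexConj L (dV₀ k) = dV₀ k) (hdV₀0 : ∀ k, dV₀ k ≠ 0)
        (χb : HeckeCharacter L) (hχbs : IsSplittingChar L 1 χb),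
        ∀ (v : HeightOneSpectrum (𝓞 (Fp L))) (c₁ : (Fp L)ˣ) (dV₁ : Fin 3 → L) (hdV₁ : ∀ k, IsCMField.complexConj L (dV₁ k) = dV₁ k) (hdV₁0 : ∀ k, dV₁ k ≠ 0),
        (∀ k, dV₁ k = ((c₁ : Fp L) : L) * dV₀ k) → ¬ IsSquare (algebraMap (Fp L) (v.adicCompletion (Fp L)) (cmQuadraticGenerator L : Fp L)) → hilbertSymbol (v.adicCompletion (Fp L)) (algebraMap (Fp L) _ ((c₁ : (Fp L)ˣ) : Fp L)) (algebraMap (Fp L) _ (cmQuadraticGenerator L : Fp L)) = -1 →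
        ∀ (w₀ : PlacesOver L v), IsCMField.complexConj L • w₀.1 = w₀.1 → ¬ Algebra.IsUnramifiedIn (𝓞 L) v.asIdeal →
        localDegPS (Fp L) L (IsCMField.complexConj L) (complexConj_imagUnit L) (imagUnit_ne_zero L) (imagUnit_mul_self L)
            v 2 (gramR_isSymm L e dV hdV dW hdW) (hermD_eq_map_gramD L e dV hdV dW hdW) (fun w => (χb ^ 3).localComponent w.1) ((((3 : ℕ) : ℂ) - ((2 : ℕ) : ℂ)) / 2) ≤
          localSWImage L e dV hdV dW hdW eW e' dV₀ hdV₀ v ((finSplittings L e' dV hdV hdV0 (tensorFrame L dW eW dV₀) (tensorFrame_real L dW hdW eW dV₀ hdV₀) (tensorFrame_ne_zero L dW eW dV₀ hdW0 hdV₀0) χb (borelPlaceMeasure L) (cmFinLocalFamily L e' dV hdV hdV0 (tensorFrame L dW eW dV₀) (tensorFrame_real L dW hdW eW dV₀ hdV₀) (tensorFrame_ne_zero L dW eW dV₀ hdW0 hdV₀0) χb hχbs (borelPlaceMeasure L))).s v)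
            ⟨(ratSpLoc (Fp L) (n' + n') (gramD L e' dV hdV (tensorFrame L dW eW dV₀) (tensorFrame_real L dW hdW eW dV₀ hdV₀))
                  (isUnit_det_gramD L e' dV hdV hdV0 (tensorFrame L dW eW dV₀) (tensorFrame_real L dW hdW eW dV₀ hdV₀) (tensorFrame_ne_zero L dW eW dV₀ hdW0 hdV₀0)) v (deltaD L),
                deltaImpl L e' dV hdV hdV0 (tensorFrame L dW eW dV₀) (tensorFrame_real L dW hdW eW dV₀ hdV₀) (tensorFrame_ne_zero L dW eW dV₀ hdW0 hdV₀0) χb (borelPlaceMeasure L) (cmFinLocalFamily L e' dV hdV hdV0 (tensorFrame L dW eW dV₀) (tensorFrame_real L dW hdW eW dV₀ hdV₀) (tensorFrame_ne_zero L dW eW dV₀ hdW0 hdV₀0) χb hχbs (borelPlaceMeasure L)) v),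
              deltaPair_mem_localMp L e' dV hdV hdV0 (tensorFrame L dW eW dV₀) (tensorFrame_real L dW hdW eW dV₀ hdV₀) (tensorFrame_ne_zero L dW eW dV₀ hdW0 hdV₀0) χb (borelPlaceMeasure L) (cmFinLocalFamily L e' dV hdV hdV0 (tensorFrame L dW eW dV₀) (tensorFrame_real L dW hdW eW dV₀ hdV₀) (tensorFrame_ne_zero L dW eW dV₀ hdW0 hdV₀0) χb hχbs (borelPlaceMeasure L)) v⟩ ⊔
          localSWImage L e dV hdV dW hdW eW e' dV₁ hdV₁ v ((finSplittings L e' dV hdV hdV0 (tensorFrame L dW eW dV₁) (tensorFrame_real L dW hdW eW dV₁ hdV₁) (tensorFrame_ne_zero L dW eW dV₁ hdW0 hdV₁0) χb (borelPlaceMeasure L) (cmFinLocalFamily L e' dV hdV hdV0 (tensorFrame L dW eW dV₁) (tensorFrame_real L dW hdW eW dV₁ hdV₁) (tensorFrame_ne_zero L dW eW dV₁ hdW0 hdV₁0) χb hχbs (borelPlaceMeasure L))).s v)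
            ⟨(ratSpLoc (Fp L) (n' + n') (gramD L e' dV hdV (tensorFrame L dW eW dV₁) (tensorFrame_real L dW hdW eW dV₁ hdV₁))
                  (isUnit_det_gramD L e' dV hdV hdV0 (tensorFrame L dW eW dV₁) (tensorFrame_real L dW hdW eW dV₁ hdV₁) (tensorFrame_ne_zero L dW eW dV₁ hdW0 hdV₁0)) v (deltaD L),
                deltaImpl L e' dV hdV hdV0 (tensorFrame L dW eW dV₁) (tensorFrame_real L dW hdW eW dV₁ hdV₁) (tensorFrame_ne_zero L dW eW dV₁ hdW0 hdV₁0) χb (borelPlaceMeasure L) (cmFinLocalFamily L e' dV hdV hdV0 (tensorFrame L dW eW dV₁) (tensorFrame_real L dW hdW eW dV₁ hdV₁) (tensorFrame_ne_zero L dW eW dV₁ hdW0 hdV₁0) χb hχbs (borelPlaceMeasure L)) v),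
              deltaPair_mem_localMp L e' dV hdV hdV0 (tensorFrame L dW eW dV₁) (tensorFrame_real L dW hdW eW dV₁ hdV₁) (tensorFrame_ne_zero L dW eW dV₁ hdW0 hdV₁0) χb (borelPlaceMeasure L) (cmFinLocalFamily L e' dV hdV hdV0 (tensorFrame L dW eW dV₁) (tensorFrame_real L dW hdW eW dV₁ hdV₁) (tensorFrame_ne_zero L dW eW dV₁ hdW0 hdV₁0) χb hχbs (borelPlaceMeasure L)) v⟩) :
    ∀ (L : Type) [Field L] [NumberField L] [IsCMField L] (e : Fin 2 × Fin 1 ≃ Fin 2)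
      (dV : Fin 2 → L) (hdV : ∀ i, IsCMField.complexConj L (dV i) = dV i) (hdV0 : ∀ i, dV i ≠ 0)
      (dW : Fin 1 → L) (hdW : ∀ i, IsCMField.complexConj L (dW i) = dW i) (hdW0 : ∀ i, dW i ≠ 0)
      {M' n' : ℕ} (eW : Fin 1 × Fin 3 ≃ Fin M') (e' : Fin 2 × Fin M' ≃ Fin n')
      (dV₀ : Fin 3 → L) (hdV₀ : ∀ k, IsCMField.complexConj L (dV₀ k) = dV₀ k) (hdV₀0 : ∀ k, dV₀ k ≠ 0)
      (χb : HeckeCharacter L) (hχbs : IsSplittingChar L 1 χb),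
      ∀ (v : HeightOneSpectrum (𝓞 (Fp L))) (c₁ : (Fp L)ˣ) (dV₁ : Fin 3 → L) (hdV₁ : ∀ k, IsCMField.complexConj L (dV₁ k) = dV₁ k) (hdV₁0 : ∀ k, dV₁ k ≠ 0),
      (∀ k, dV₁ k = ((c₁ : Fp L) : L) * dV₀ k) → ¬ IsSquare (algebraMap (Fp L) (v.adicCompletion (Fp L)) (cmQuadraticGenerator L : Fp L)) → hilbertSymbol (v.adicCompletion (Fp L)) (algebraMap (Fp L) _ ((c₁ : (Fp L)ˣ) : Fp L)) (algebraMap (Fp L) _ (cmQuadraticGenerator L : Fp L)) = -1 →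
      localDegPS (Fp L) L (IsCMField.complexConj L) (complexConj_imagUnit L) (imagUnit_ne_zero L) (imagUnit_mul_self L)
          v 2 (gramR_isSymm L e dV hdV dW hdW) (hermD_eq_map_gramD L e dV hdV dW hdW) (fun w => (χb ^ 3).localComponent w.1) ((((3 : ℕ) : ℂ) - ((2 : ℕ) : ℂ)) / 2) ≤
        localSWImage L e dV hdV dW hdW eW e' dV₀ hdV₀ v ((finSplittings L e' dV hdV hdV0 (tensorFrame L dW eW dV₀) (tensorFrame_real L dW hdW eW dV₀ hdV₀) (tensorFrame_ne_zero L dW eW dV₀ hdW0 hdV₀0) χb (borelPlaceMeasure L) (cmFinLocalFamily L e' dV hdV hdV0 (tensorFrame L dW eW dV₀) (tensorFrame_real L dW hdW eW dV₀ hdV₀) (tensorFrame_ne_zero L dW eW dV₀ hdW0 hdV₀0) χb hχbs (borelPlaceMeasure L))).s v)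
          ⟨(ratSpLoc (Fp L) (n' + n') (gramD L e' dV hdV (tensorFrame L dW eW dV₀) (tensorFrame_real L dW hdW eW dV₀ hdV₀))
                (isUnit_det_gramD L e' dV hdV hdV0 (tensorFrame L dW eW dV₀) (tensorFrame_real L dW hdW eW dV₀ hdV₀) (tensorFrame_ne_zero L dW eW dV₀ hdW0 hdV₀0)) v (deltaD L),
              deltaImpl L e' dV hdV hdV0 (tensorFrame L dW eW dV₀) (tensorFrame_real L dW hdW eW dV₀ hdV₀) (tensorFrame_ne_zero L dW eW dV₀ hdW0 hdV₀0) χb (borelPlaceMeasure L) (cmFinLocalFamily L e' dV hdV hdV0 (tensorFrame L dW eW dV₀) (tensorFrame_real L dW hdW eW dV₀ hdV₀) (tensorFrame_ne_zero L dW eW dV₀ hdW0 hdV₀0) χb hχbs (borelPlaceMeasure L)) v),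
            deltaPair_mem_localMp L e' dV hdV hdV0 (tensorFrame L dW eW dV₀) (tensorFrame_real L dW hdW eW dV₀ hdV₀) (tensorFrame_ne_zero L dW eW dV₀ hdW0 hdV₀0) χb (borelPlaceMeasure L) (cmFinLocalFamily L e' dV hdV hdV0 (tensorFrame L dW eW dV₀) (tensorFrame_real L dW hdW eW dV₀ hdV₀) (tensorFrame_ne_zero L dW eW dV₀ hdW0 hdV₀0) χb hχbs (borelPlaceMeasure L)) v⟩ ⊔
        localSWImage L e dV hdV dW hdW eW e' dV₁ hdV₁ v ((finSplittings L e' dV hdV hdV0 (tensorFrame L dW eW dV₁) (tensorFrame_real L dW hdW eW dV₁ hdV₁) (tensorFrame_ne_zero L dW eW dV₁ hdW0 hdV₁0) χb (borelPlaceMeasure L) (cmFinLocalFamily L e' dV hdV hdV0 (tensorFrame L dW eW dV₁) (tensorFrame_real L dW hdW eW dV₁ hdV₁) (tensorFrame_ne_zero L dW eW dV₁ hdW0 hdV₁0) χb hχbs (borelPlaceMeasure L))).s v)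
          ⟨(ratSpLoc (Fp L) (n' + n') (gramD L e' dV hdV (tensorFrame L dW eW dV₁) (tensorFrame_real L dW hdW eW dV₁ hdV₁))
                (isUnit_det_gramD L e' dV hdV hdV0 (tensorFrame L dW eW dV₁) (tensorFrame_real L dW hdW eW dV₁ hdV₁) (tensorFrame_ne_zero L dW eW dV₁ hdW0 hdV₁0)) v (deltaD L),
              deltaImpl L e' dV hdV hdV0 (tensorFrame L dW eW dV₁) (tensorFrame_real L dW hdW eW dV₁ hdV₁) (tensorFrame_ne_zero L dW eW dV₁ hdW0 hdV₁0) χb (borelPlaceMeasure L) (cmFinLocalFamily L e' dV hdV hdV0 (tensorFrame L dW eW dV₁) (tensorFrame_real L dW hdW eW dV₁ hdV₁) (tensorFrame_ne_zero L dW eW dV₁ hdW0 hdV₁0) χb hχbs (borelPlaceMeasure L)) v),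
            deltaPair_mem_localMp L e' dV hdV hdV0 (tensorFrame L dW eW dV₁) (tensorFrame_real L dW hdW eW dV₁ hdV₁) (tensorFrame_ne_zero L dW eW dV₁ hdW0 hdV₁0) χb (borelPlaceMeasure L) (cmFinLocalFamily L e' dV hdV hdV0 (tensorFrame L dW eW dV₁) (tensorFrame_real L dW hdW eW dV₁ hdV₁) (tensorFrame_ne_zero L dW eW dV₁ hdW0 hdV₁0) χb hχbs (borelPlaceMeasure L)) v⟩ := by
  intro L _ _ _ e dV hdV hdV0 dW hdW hdW0 M' n' eW e' dV₀ hdV₀ hdV₀0 χb hχbs v c₁ dV₁ hdV₁ hdV₁0 haV₁ hns hc₁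
  obtain ⟨w₀⟩ := (inferInstance : Nonempty (PlacesOver L v))
  have hw₀ : IsCMField.complexConj L • w₀.1 = w₀.1 := by
    by_contra h
    exact hns ((isSquare_cmQuadraticGenerator_iff_exists_smul_ne L v).2 ⟨w₀, h⟩)
  by_cases hv : Algebra.IsUnramifiedIn (𝓞 L) v.asIdeal
  · exact hI L e dV hdV hdV0 dW hdW hdW0 eW e' dV₀ hdV₀ hdV₀0 χb hχbs v c₁ dV₁ hdV₁ hdV₁0 haV₁ hns hc₁ w₀ hw₀ hv
  · exact hR L e dV hdV hdV0 dW hdW hdW0 eW e' dV₀ hdV₀ hdV₀0 χb hχbs v c₁ dV₁ hdV₁ hdV₁0 haV₁ hns hc₁ w₀ hw₀ hv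

end Summit.HodgeConjecture.HodgeConjecture.Cruxes.HLiu418.K2LiuLocalSWSpanningNonsplitFaceClosed

end
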